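import Literature.Computability.MetaComplexity.ListDecodableCodeAdviceDecoder
import Literature.Computability.Complexity.IrreducibilityLLLKernelFP
import Literature.Computability.Complexity.IrreducibilityLLLPrimeSearchFP
import Literature.Computability.Complexity.CodeFPListKit
import HarnessLib

/-!
# A polynomial-time list-decodable binary code (Hirahara 2018, Thm. 4.7), V: encoder and advised decoder run in polynomial time

Topic `Literature/Computability/MetaComplexity`, machine side of `ListDecodableCode.lean` (the
code `LDC.enc`) and `ListDecodableCodeAdviceDecoder.lean` (the advised decoder `LDC.decodeL`) of
S. Hirahara, *Non-black-box worst-case to average-case reductions within NP*, FOCS 2018 / ECCC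
TR18-138, **Thm. 4.7**: "*`Enc_{n,ε}` and its list decoder `Dec_{n,ε}` are computable in time
`poly(n, 1/ε)`*". Everything is assembled in the typed polynomial-time algebra `CodeFP`
(`CodeFP*.lean`; Arora–Barak §1.3: composition and polynomially bounded loops) from bricks already
in the tree — dense polynomial arithmetic modulo `M` on coefficient lists
(`SumcheckPolyArith.lean`, `IrreducibilityLLLPolyArith(FP).lean`: `paddC`, `pmulC`, `pmodC`,
`pnormC`), Fermat inverses and powers (`IrreducibilityLLLGcdFP.invModC`, `powModC`), the null vector by column
elimination (`IrreducibilityLLLKernelFP.kerVecModC`), trial division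
(`IrreducibilityLLLPrimeSearchFP.isPrimeTDC`) — plus the four folds of the outer decoder, whose
accumulators are reduced coefficient lists of bounded length:

* `LDC.shiftLC` (Taylor shift by Horner), `LDC.hornerZC`, `LDC.evalTruncLC` (`R(Z, g) mod Z^N`),
  `LDC.newtonRunLC` (Newton's iteration), `LDC.derivLC`, `LDC.tabLC`, `LDC.decodeCoreLC`;
* the parameters `bOf`, `qOf` (least prime above `2^{b-1}` by trial division over `(2^{b-1}, 2^b]`,
  `qSearch_eq`), the inner lists `candL` (Hadamard bits by integer arithmetic, `hadN_eq_decide`),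
  the points, the rows of Sudan's system, `LDC.decodeLC`;
* the encoder: `LDC.symb_eq_hornerZ` (the Reed–Solomon symbol is a Horner value), `LDC.symbC`, `LDC.encC`;
* the string functions: **`LDC.exists_encFn`, `LDC.exists_decFn`** — `FP` functions reading `⟨1ᵉ, x⟩`,
  resp. `⟨adv, ⟨1ᵉ, ⟨1ⁿ, r⟩⟩⟩` (advice fields `advFields adv = (μ, β, v)`), with their values.

As in the `LLLFactoring` files every modulus entering a reduction is `q⁺ = max q 2` (the identity
on the prime `qOf n e`), so that all accumulator bounds hold on every input; the parameters `bOf`,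
`capOf`, … are made locally irreducible before the assembly (definitional unfolding of `2^{b}` or
`(n+e+2)^{48}` inside a conversion check is astronomically expensive), and every identity is proved by
rewriting. Everything is proved; no machine is written and no named fact is introduced.

## References

* S. Hirahara, ECCC TR18-138 (2018) / FOCS 2018, Thm. 4.7 [Hirahara2018].
* S. Arora, B. Barak, *Computational Complexity: A Modern Approach*, CUP 2009, §1.3, §19.3–19.4
  [AroraBarakCC2009].
* D. E. Knuth, *The Art of Computer Programming*, Vol. 2, 3rd ed., 1998, §4.6.1–4.6.4 [KnuthTAOCP2].
-/

noncomputable section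

namespace Literature.Computability.MetaComplexity

open _root_.Computability Polynomial Complexity Complexity.Brick Complexity.CodeFP
  Literature.Computability.Complexity.LLLFactoring Literature.Computability.Complexity.SumcheckMA
  Literature.Algebra.EuclideanLattices.Khot

namespace LDC

/-- The code of integer lists. [folklore] -/
local notation "L" => rawE intE

/-! ### Sizes of reduced data -/

/-- A reduced scalar modulo `M⁺` has a short code. [folklore] -/
theorem length_intE_le_of_reduced_max {M : ℕ} {z : ℤ} (h : 0 ≤ z ∧ z < (max M 2 : ℕ)) : (intE z).length ≤ 3 * M + 8 :=
  (length_intE_le_of_lt_max h.1 h.2).trans (by have hsz : Nat.size M ≤ M := Nat.size_le.2 Nat.lt_two_pow_self; omega)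

/-- `0 < max M 2`. [folklore] -/
theorem max_two_pos (M : ℕ) : 0 < max M 2 := lt_of_lt_of_le two_pos (le_max_right M 2)

/-! ### Strings and raw bit lists -/

/-- A string as the raw list of its bits (twin of `PCPToCMMSA.strBits` / `codeFP_strToRaw`, which live in
machine files outside this import cone). [folklore] -/
theorem strToRaw : CodeFP strE (rawE bitE) (fun l : List Bool => l) := by
  have h := strChunks.comp (strLength.pair ((const strE (1 : ℕ)).pair (CodeFP.id strE)))
  refine h.recodeOut fun l => ?_
  show rawE strE ((List.range l.length).map fun i => (l.drop (i * 1)).take 1) = rawE bitE l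
  unfold rawE
  congr 1
  rw [List.map_map]
  apply List.ext_getElem
  · simp
  · intro i h₁ h₂
    rw [List.length_map, List.length_range] at h₁
    simp [bitE, strE, List.take_one_drop_eq_of_lt_length h₁]

/-- Folding `append singleton` rebuilds the list (twin of `CodeFP.foldl_append_singleton_self`). [folklore] -/
theorem foldl_append_singleton_self' {α : Type} (l acc : List α) : l.foldl (fun acc b => acc ++ [b]) acc = acc ++ l := by
  induction l generalizing acc with
  | nil => simp
  | cons a l ih => rw [List.foldl_cons, ih, List.append_assoc, List.singleton_append]

/-- A raw list of bits as a string (twin of `CodeFP.bitsToStr`, `CodeFPStrings.lean`, kept out of the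
imports: that file is under active extension). [folklore] -/
theorem rawToStr : CodeFP (rawE bitE) strE (fun l : List Bool => l) := by
  have hsing : CodeFP bitE strE (fun b : Bool => [b]) := ⟨_root_.id, PolyTimeComputable.id _, fun _ => rfl⟩
  have hstep : CodeFP (pairE bitE strE) strE (fun t => t.2 ++ [t.1]) := (strAppend.comp ((snd _ _).pair (hsing.comp (fst _ _))) :)
  have h := foldl₀ (step := fun (b : Bool) (acc : List Bool) => acc ++ [b]) (b₀ := []) hstep X (fun l₁ l₂ => by
    rw [foldl_append_singleton_self', List.nil_append, eval_X]
    have h1 := length_le_length_rawE bitE (l₁ ++ l₂)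
    rw [List.length_append] at h1
    change l₁.length ≤ _
    omega)
  exact h.congr fun l => by rw [foldl_append_singleton_self', List.nil_append]

/-- Reading a bit of a string at a binary index (twin of `CodeFP.strGetDNat`, `CodeFPStrings.lean`, kept out of the
imports like `rawToStr`). [folklore] -/
theorem strGetD' : CodeFP (pairE strE natE) bitE (fun p => p.1.getD p.2 false) :=
  ((rawGetOr bitE).comp ((strToRaw.comp (fst _ _)).pair ((snd _ _).pair (const _ false))) :)

/-! ### The Taylor shift -/

/-- `shiftL` as a left fold over the reversed list. [folklore] -/
theorem shiftL_eq_foldl (q : ℕ) (β : ℤ) (a : List ℤ) : shiftL q β a = a.reverse.foldl (fun acc c => shiftStepL q β c acc) [] := by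
  rw [shiftL, List.foldl_reverse]

/-- One Horner step on codes: `((M, β), c, acc) ↦ shiftStepL M⁺ β c acc`. [cite: KnuthTAOCP2, §4.6.4] [cite: AroraBarakCC2009, §1.3] -/
theorem shiftStepLC : CodeFP (pairE (pairE unE intE) (pairE intE L)) L (fun t => shiftStepL (max t.1.1 2) t.1.2 t.2.1 t.2.2) := by
  have hM : CodeFP (pairE (pairE unE intE) (pairE intE L)) natE (fun t => max t.1.1 2) := (maxTwoUnC.comp (fst _ _).fst' :)
  have hlin : CodeFP (pairE (pairE unE intE) (pairE intE L)) L (fun t => [t.1.2, 1]) :=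
    ((rawCons intE).comp ((fst _ _).snd'.pair (const _ [(1 : ℤ)])) :)
  have hc : CodeFP (pairE (pairE unE intE) (pairE intE L)) L (fun t => [t.2.1]) := ((rawSingleton intE).comp (snd _ _).fst' :)
  exact (pnormC.comp (hM.pair (paddC.comp (hc.pair (pmulC.comp (hlin.pair (snd _ _).snd')))))).congr fun _ => rfl

/-- **The Taylor shift on codes**: `(M, β, a) ↦ shiftL M⁺ β a` (a fold over the reversed list; the
accumulator is a normal list modulo `M⁺` not longer than the input). [cite: KnuthTAOCP2, §4.6.4] [cite: AroraBarakCC2009, §1.3] -/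
theorem shiftLC : CodeFP (pairE unE (pairE intE L)) L (fun t => shiftL (max t.1 2) t.2.1 t.2.2) := by
  have hfold := foldl (σ := ℕ × ℤ) (α := ℤ) (β := List ℤ) (eσ := pairE unE intE) (eα := intE) (eβ := L)
    (step := fun s c acc => shiftStepL (max s.1 2) s.2 c acc) (init := fun _ => []) shiftStepLC (const _ ([] : List ℤ))
    (X * (12 * X + 18)) (fun s l₁ l₂ => by
      obtain ⟨M, β⟩ := s
      set Lc := (pairE (pairE unE intE) L ((M, β), l₁ ++ l₂)).length with hLc
      have hacc : l₁.foldl (fun acc c => shiftStepL (max M 2) β c acc) [] = shiftL (max M 2) β l₁.reverse := by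
        rw [shiftL_eq_foldl, List.reverse_reverse]
      change (rawE intE (l₁.foldl (fun acc c => shiftStepL (max M 2) β c acc) [])).length ≤ _
      rw [hacc]
      have hred := reduced_shiftL (max_two_pos M) β l₁.reverse
      have hlen : (shiftL (max M 2) β l₁.reverse).length ≤ Lc := by
        refine (length_shiftL_le (max_two_pos M) β _).trans ?_
        rw [List.length_reverse, hLc]
        simp only [pairE_apply, length_boolPair]
        have := length_le_code (l₁ ++ l₂); rw [List.length_append] at this; omega
      have hM : Nat.size M ≤ Lc := by
        rw [hLc]; simp only [pairE_apply, length_boolPair, length_unE]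
        have hsz : Nat.size M ≤ M := Nat.size_le.2 Nat.lt_two_pow_self; omega
      have h := length_code_le_of_reduced_max hred hlen hM
      simpa only [eval_mul, eval_add, eval_X, eval_ofNat] using h)
  exact (hfold.comp (((fst _ _).pair (snd _ _).fst').pair ((rawReverse intE).comp (snd _ _).snd'))).congr fun t => by
    simp only [shiftL_eq_foldl]

/-! ### Horner evaluation at a point -/

/-- `hornerZ` as a left fold over the reversed list. [folklore] -/
theorem hornerZ_eq_foldl (q : ℕ) (a : List ℤ) (β : ℤ) :
    hornerZ q a β = a.reverse.foldl (fun acc c => (c + β * acc) % (q : ℤ)) 0 := by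
  rw [hornerZ, List.foldl_reverse]

/-- The partial Horner values are reduced (`q ≥ 1`). [folklore] -/
theorem foldl_horner_bounds {q : ℕ} (hq : 0 < q) (β : ℤ) : ∀ (l : List ℤ) (acc : ℤ), 0 ≤ acc ∧ acc < q →
    0 ≤ l.foldl (fun acc c => (c + β * acc) % (q : ℤ)) acc ∧ l.foldl (fun acc c => (c + β * acc) % (q : ℤ)) acc < q
  | [], acc, h => h
  | c :: l, acc, _ => by
    have hq' : (0 : ℤ) < q := by exact_mod_cast hq
    exact foldl_horner_bounds hq β l _ ⟨Int.emod_nonneg _ hq'.ne', Int.emod_lt_of_pos _ hq'⟩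

/-- **Horner evaluation on codes**: `(M, a, β) ↦ hornerZ M⁺ a β`. [cite: KnuthTAOCP2, §4.6.4] [cite: AroraBarakCC2009, §1.3] -/
theorem hornerZC : CodeFP (pairE unE (pairE L intE)) intE (fun t => hornerZ (max t.1 2) t.2.1 t.2.2) := by
  have hstep : CodeFP (pairE (pairE unE intE) (pairE intE intE)) intE
      (fun t => (t.2.1 + t.1.2 * t.2.2) % ((max t.1.1 2 : ℕ) : ℤ)) :=
    (intEMod.comp ((intAdd.comp ((snd _ _).fst'.pair (intMul.comp ((fst _ _).snd'.pair (snd _ _).snd')))).pair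
      (intOfNat.comp (maxTwoUnC.comp (fst _ _).fst'))) :)
  have hfold := foldl (σ := ℕ × ℤ) (α := ℤ) (β := ℤ) (eσ := pairE unE intE) (eα := intE) (eβ := intE)
    (step := fun s c acc => (c + s.2 * acc) % ((max s.1 2 : ℕ) : ℤ)) (init := fun _ => 0) hstep (const _ (0 : ℤ))
    (3 * X + 8) (fun s l₁ l₂ => by
      obtain ⟨M, β⟩ := s
      change (intE (l₁.foldl (fun acc c => (c + β * acc) % ((max M 2 : ℕ) : ℤ)) 0)).length ≤ _
      have hb := foldl_horner_bounds (max_two_pos M) β l₁ 0 ⟨le_rfl, by exact_mod_cast max_two_pos M⟩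
      refine (length_intE_le_of_reduced_max hb).trans ?_
      simp only [eval_add, eval_mul, eval_X, eval_ofNat, pairE_apply, length_boolPair, length_unE]
      omega)
  exact (hfold.comp (((fst _ _).pair (snd _ _).snd').pair ((rawReverse intE).comp (snd _ _).fst'))).congr fun t => by
    simp only [hornerZ_eq_foldl]


/-! ### A reducing product of scalars -/

/-- The product of a list of integers, reduced modulo `q` after every factor. [cite: AroraBarakCC2009, §A.3] -/
def prodModZ (q : ℕ) (l : List ℤ) : ℤ := l.foldl (fun acc c => acc * c % (q : ℤ)) (1 % (q : ℤ))

/-- `prodModZ q l = l.prod mod q`. [folklore] -/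
theorem prodModZ_eq (q : ℕ) (l : List ℤ) : prodModZ q l = l.prod % (q : ℤ) := by
  suffices h : ∀ acc : ℤ, l.foldl (fun acc c => acc * c % (q : ℤ)) (acc % (q : ℤ)) = (acc * l.prod) % (q : ℤ) by
    rw [prodModZ, h 1, one_mul]
  induction l with
  | nil => intro acc; simp
  | cons c l ih =>
    intro acc
    rw [List.foldl_cons, List.prod_cons, ← mul_assoc, ← ih (acc * c), Int.mul_emod, Int.emod_emod_of_dvd _ dvd_rfl, ← Int.mul_emod]

/-- The partial products are reduced (`q ≥ 1`). [folklore] -/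
theorem foldl_prodMod_bounds {q : ℕ} (hq : 0 < q) : ∀ (l : List ℤ) (acc : ℤ), 0 ≤ acc ∧ acc < q →
    0 ≤ l.foldl (fun acc c => acc * c % (q : ℤ)) acc ∧ l.foldl (fun acc c => acc * c % (q : ℤ)) acc < q
  | [], acc, h => h
  | c :: l, acc, _ => by
    have hq' : (0 : ℤ) < q := by exact_mod_cast hq
    exact foldl_prodMod_bounds hq l _ ⟨Int.emod_nonneg _ hq'.ne', Int.emod_lt_of_pos _ hq'⟩

/-- **The reducing product on codes**: `(M, l) ↦ prodModZ M⁺ l`. [cite: AroraBarakCC2009, §1.3, §A.3] -/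
theorem prodModZC : CodeFP (pairE unE L) intE (fun t => prodModZ (max t.1 2) t.2) := by
  have hstep : CodeFP (pairE unE (pairE intE intE)) intE (fun t => t.2.2 * t.2.1 % ((max t.1 2 : ℕ) : ℤ)) :=
    (intEMod.comp ((intMul.comp ((snd _ _).snd'.pair (snd _ _).fst')).pair (intOfNat.comp (maxTwoUnC.comp (fst _ _)))) :)
  have hinit : CodeFP unE intE (fun M => 1 % ((max M 2 : ℕ) : ℤ)) := (intEMod.comp ((const _ (1 : ℤ)).pair (intOfNat.comp maxTwoUnC)) :)
  have hfold := foldl (σ := ℕ) (α := ℤ) (β := ℤ) (eσ := unE) (eα := intE) (eβ := intE)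
    (step := fun M c acc => acc * c % ((max M 2 : ℕ) : ℤ)) (init := fun M => 1 % ((max M 2 : ℕ) : ℤ)) hstep hinit
    (3 * X + 8) (fun M l₁ l₂ => by
      change (intE (l₁.foldl (fun acc c => acc * c % ((max M 2 : ℕ) : ℤ)) (1 % ((max M 2 : ℕ) : ℤ)))).length ≤ _
      have hM' : (0 : ℤ) < (max M 2 : ℕ) := by exact_mod_cast max_two_pos M
      have hb := foldl_prodMod_bounds (max_two_pos M) l₁ (1 % ((max M 2 : ℕ) : ℤ)) ⟨Int.emod_nonneg _ hM'.ne', Int.emod_lt_of_pos _ hM'⟩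
      refine (length_intE_le_of_reduced_max hb).trans ?_
      simp only [eval_add, eval_mul, eval_X, eval_ofNat, pairE_apply, length_boolPair, length_unE]
      omega)
  exact hfold.congr fun _ => rfl

/-! ### Truncated evaluation and Newton's iteration -/

/-- `evalTruncL` as a left fold over the reversed row list. [folklore] -/
theorem evalTruncL_eq_foldl (q N : ℕ) (R : List (List ℤ)) (g : List ℤ) :
    evalTruncL q N R g = R.reverse.foldl (fun acc row => evalTruncStepL q N g row acc) [] := by
  rw [evalTruncL, List.foldl_reverse]

/-- One Horner step in `Y` on codes: `(((M, N), g), row, acc) ↦ evalTruncStepL M⁺ N g row acc`.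
[cite: KnuthTAOCP2, §4.6.4] [cite: AroraBarakCC2009, §1.3] -/
theorem evalTruncStepLC : CodeFP (pairE (pairE (pairE unE unE) L) (pairE L L)) L
    (fun t => evalTruncStepL (max t.1.1.1 2) t.1.1.2 t.1.2 t.2.1 t.2.2) := by
  have hM : CodeFP (pairE (pairE (pairE unE unE) L) (pairE L L)) natE (fun t => max t.1.1.1 2) := (maxTwoUnC.comp (fst _ _).fst'.fst' :)
  have hN : CodeFP (pairE (pairE (pairE unE unE) L) (pairE L L)) unE (fun t => t.1.1.2) := ((fst _ _).fst'.snd' :)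
  have hsum : CodeFP (pairE (pairE (pairE unE unE) L) (pairE L L)) L (fun t => padd t.2.1 (pmul t.1.2 t.2.2)) :=
    (paddC.comp ((snd _ _).fst'.pair (pmulC.comp ((fst _ _).snd'.pair (snd _ _).snd'))) :)
  exact (pmodC.comp (hM.pair ((rawTakeUn intE).comp (hN.pair hsum)))).congr fun _ => rfl

/-- **Truncated evaluation on codes**: `((M, N), g, R) ↦ evalTruncL M⁺ N R g` (a fold over the
reversed rows; the accumulator is reduced of length `≤ N`). [cite: AroraBarakCC2009, §1.3] -/
theorem evalTruncLC : CodeFP (pairE (pairE unE unE) (pairE L (rawE L))) L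
    (fun t => evalTruncL (max t.1.1 2) t.1.2 t.2.2 t.2.1) := by
  have hfold := foldl (σ := (ℕ × ℕ) × List ℤ) (α := List ℤ) (β := List ℤ) (eσ := pairE (pairE unE unE) L) (eα := L) (eβ := L)
    (step := fun s row acc => evalTruncStepL (max s.1.1 2) s.1.2 s.2 row acc) (init := fun _ => []) evalTruncStepLC
    (const _ ([] : List ℤ)) (X * (12 * X + 18)) (fun s l₁ l₂ => by
      obtain ⟨⟨M, N⟩, g⟩ := s
      set Lc := (pairE (pairE (pairE unE unE) L) (rawE L) (((M, N), g), l₁ ++ l₂)).length with hLc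
      have hacc : l₁.foldl (fun acc row => evalTruncStepL (max M 2) N g row acc) [] = evalTruncL (max M 2) N l₁.reverse g := by
        rw [evalTruncL_eq_foldl, List.reverse_reverse]
      change (rawE intE (l₁.foldl (fun acc row => evalTruncStepL (max M 2) N g row acc) [])).length ≤ _
      rw [hacc]
      have hsz := evalTruncL_size (max_two_pos M) N g l₁.reverse
      have hN : N ≤ Lc := by
        rw [hLc]; simp only [pairE_apply, length_boolPair, length_unE]; omega
      have hM : Nat.size M ≤ Lc := by
        rw [hLc]; simp only [pairE_apply, length_boolPair, length_unE]
        have hsz : Nat.size M ≤ M := Nat.size_le.2 Nat.lt_two_pow_self; omega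
      have h := length_code_le_of_reduced_max hsz.1 (hsz.2.trans hN) hM
      simpa only [eval_mul, eval_add, eval_X, eval_ofNat] using h)
  exact (hfold.comp ((((fst _ _).pair (snd _ _).fst')).pair ((rawReverse L).comp (snd _ _).snd'))).congr fun t => by
    simp only [evalTruncL_eq_foldl]

/-- The Newton fold over an arbitrary index list keeps a reduced accumulator of the same length
(`q ≥ 1`). [folklore] -/
theorem newtonFold_size {q : ℕ} (hq : 0 < q) (N : ℕ) (R : List (List ℤ)) (a₀ δinv : ℤ) (ms : List ℕ) :
    Reduced q (ms.foldl (fun g m => g ++ [newtonStepL q N R a₀ δinv g m]) []) ∧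
      (ms.foldl (fun g m => g ++ [newtonStepL q N R a₀ δinv g m]) []).length = ms.length := by
  induction ms using List.reverseRecOn with
  | nil => exact ⟨fun c hc => by simp at hc, rfl⟩
  | append_singleton ms m ih =>
    rw [List.foldl_append, List.foldl_cons, List.foldl_nil, List.length_append, List.length_append, ← ih.2]
    refine ⟨fun c hc => ?_, by simp⟩
    rcases List.mem_append.1 hc with h | h
    · exact ih.1 c h
    · rw [List.mem_singleton.1 h]; exact newtonStepL_bounds hq N R a₀ δinv _ _

/-- The code of the Newton context. [folklore] -/
local notation "NWT" => pairE (pairE unE unE) (pairE (rawE L) (pairE intE intE))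

/-- **One Newton step on codes**: `((((M, N), R, a₀, δinv)), m, g) ↦ newtonStepL M⁺ N R a₀ δinv g m`.
[cite: Hirahara2018, Thm. 4.7 (decoding)] [cite: AroraBarakCC2009, §1.3] -/
theorem newtonStepLC : CodeFP (pairE NWT (pairE natE L)) intE
    (fun t => newtonStepL (max t.1.1.1 2) t.1.1.2 t.1.2.1 t.1.2.2.1 t.1.2.2.2 t.2.2 t.2.1) := by
  have hMu : CodeFP (pairE NWT (pairE natE L)) unE (fun t => t.1.1.1) := ((fst _ _).fst'.fst' :)
  have hMz : CodeFP (pairE NWT (pairE natE L)) intE (fun t => ((max t.1.1.1 2 : ℕ) : ℤ)) := (intOfNat.comp (maxTwoUnC.comp hMu) :)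
  have hev : CodeFP (pairE NWT (pairE natE L)) L (fun t => evalTruncL (max t.1.1.1 2) t.1.1.2 t.1.2.1 t.2.2) :=
    (evalTruncLC.comp ((fst _ _).fst'.pair ((snd _ _).snd'.pair (fst _ _).snd'.fst')) :)
  have hcoef : CodeFP (pairE NWT (pairE natE L)) intE (fun t => (evalTruncL (max t.1.1.1 2) t.1.1.2 t.1.2.1 t.2.2).getD t.2.1 0) :=
    ((rawGetOr intE).comp (hev.pair ((snd _ _).fst'.pair (const _ (0 : ℤ)))) :)
  have h0 : CodeFP (pairE NWT (pairE natE L)) intE (fun t => t.1.2.2.1 % ((max t.1.1.1 2 : ℕ) : ℤ)) :=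
    (intEMod.comp ((fst _ _).snd'.snd'.fst'.pair hMz) :)
  have h1 : CodeFP (pairE NWT (pairE natE L)) intE
      (fun t => (-((evalTruncL (max t.1.1.1 2) t.1.1.2 t.1.2.1 t.2.2).getD t.2.1 0) * t.1.2.2.2) % ((max t.1.1.1 2 : ℕ) : ℤ)) :=
    (intEMod.comp ((intMul.comp ((intNeg.comp hcoef).pair (fst _ _).snd'.snd'.snd')).pair hMz) :)
  have htest : CodeFP (pairE NWT (pairE natE L)) bitE (fun t => decide (t.2.1 = 0)) :=
    (natEq.comp ((snd _ _).fst'.pair (const _ 0)) :)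
  exact (iteP htest h0 h1).congr fun t => by simp only [newtonStepL]

/-- **Newton's iteration on codes**: `((M, N), R, a₀, δinv) ↦ newtonRunL M⁺ N R a₀ δinv` (a fold over
`[0, …, N)`; the accumulator is a reduced list of length `≤ N`). [cite: Hirahara2018, Thm. 4.7 (decoding)] [cite: AroraBarakCC2009, §1.3] -/
theorem newtonRunLC : CodeFP NWT L (fun t => newtonRunL (max t.1.1 2) t.1.2 t.2.1 t.2.2.1 t.2.2.2) := by
  have hstep : CodeFP (pairE NWT (pairE natE L)) L
      (fun t => t.2.2 ++ [newtonStepL (max t.1.1.1 2) t.1.1.2 t.1.2.1 t.1.2.2.1 t.1.2.2.2 t.2.2 t.2.1]) :=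
    ((rawAppend intE).comp ((snd _ _).snd'.pair ((rawSingleton intE).comp newtonStepLC)) :)
  have hfold := foldl (σ := (ℕ × ℕ) × List (List ℤ) × ℤ × ℤ) (α := ℕ) (β := List ℤ) (eσ := NWT) (eα := natE) (eβ := L)
    (step := fun s m g => g ++ [newtonStepL (max s.1.1 2) s.1.2 s.2.1 s.2.2.1 s.2.2.2 g m]) (init := fun _ => []) hstep
    (const _ ([] : List ℤ)) (X * (12 * X + 18)) (fun s l₁ l₂ => by
      obtain ⟨⟨M, N⟩, R, a₀, δinv⟩ := s
      set Lc := (pairE NWT (rawE natE) ((((M, N), R, a₀, δinv)), l₁ ++ l₂)).length with hLc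
      change (rawE intE (l₁.foldl (fun g m => g ++ [newtonStepL (max M 2) N R a₀ δinv g m]) [])).length ≤ _
      have hsz := newtonFold_size (max_two_pos M) N R a₀ δinv l₁
      have hl : l₁.length ≤ Lc := by
        rw [hLc]; simp only [pairE_apply, length_boolPair]
        have := length_le_length_rawE natE (l₁ ++ l₂); rw [List.length_append] at this; omega
      have hM : Nat.size M ≤ Lc := by
        rw [hLc]; simp only [pairE_apply, length_boolPair, length_unE]
        have hsz : Nat.size M ≤ M := Nat.size_le.2 Nat.lt_two_pow_self; omega
      have h := length_code_le_of_reduced_max hsz.1 (hsz.2.le.trans hl) hM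
      simpa only [eval_mul, eval_add, eval_X, eval_ofNat] using h)
  exact (hfold.comp ((CodeFP.id _).pair (urange.comp (fst _ _).snd'))).congr fun t => by
    simp only [newtonRunL]
    rfl

/-! ### Tables, derivatives, the Newton denominator -/

/-- **The coefficient table on codes**: `((I, J), w) ↦ tabL I J w` (`I, J` unary). [cite: AroraBarakCC2009, §1.3] -/
theorem tabLC : CodeFP (pairE (pairE unE unE) L) (rawE L) (fun t => tabL t.1.1 t.1.2 t.2) := by
  -- row `j`: item `i ↦ w_{jI+i}` over `[0, I)`, context `(((I, J), w), j)`
  have hitem : CodeFP (pairE (pairE (pairE (pairE unE unE) L) natE) natE) intE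
      (fun t => t.1.1.2.getD (t.1.2 * t.1.1.1.1 + t.2) 0) :=
    ((rawGetOr intE).comp ((fst _ _).fst'.snd'.pair ((natAdd.comp ((natMul.comp ((fst _ _).snd'.pair
      (natOfUn.comp (fst _ _).fst'.fst'.fst'))).pair (snd _ _))).pair (const _ (0 : ℤ)))) :)
  have hrow : CodeFP (pairE (pairE (pairE unE unE) L) natE) L
      (fun t => (List.range t.1.1.1).map fun i => t.1.2.getD (t.2 * t.1.1.1 + i) 0) :=
    ((map hitem).comp ((CodeFP.id _).pair (urange.comp (fst _ _).fst'.fst')) :)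
  exact ((map hrow).comp ((CodeFP.id _).pair (urange.comp (fst _ _).snd'))).congr fun _ => rfl

/-- `Nat.descFactorial` as the product of a list (cast to `ℤ`). [folklore] -/
theorem descFactorial_eq_prod (n : ℕ) : ∀ k : ℕ, ((n.descFactorial k : ℕ) : ℤ) = ((List.range k).map fun i => ((n - i : ℕ) : ℤ)).prod
  | 0 => by simp
  | k + 1 => by
    rw [List.range_succ, List.map_append, List.prod_append, ← descFactorial_eq_prod n k, Nat.descFactorial_succ]
    push_cast
    simp [mul_comm]

/-- Scaling by `d` and by `d mod M` agree after reduction modulo `M`. [folklore] -/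
theorem pmod_pscale_mod (M : ℕ) (d : ℤ) (r : List ℤ) : pmod M (pscale (d % (M : ℤ)) r) = pmod M (pscale d r) := by
  simp only [pmod, pscale, List.map_map]
  refine List.map_congr_left fun c _ => ?_
  simp only [Function.comp_apply]
  rw [Int.mul_emod (d % (M : ℤ)) c, Int.emod_emod_of_dvd _ dvd_rfl, ← Int.mul_emod]

/-- **The `k`-th `Y`-derivative on codes**: `((M, k), rows) ↦ derivL M⁺ k rows` (`M, k` unary; the
falling factorials are taken modulo `M⁺` first, `pmod_pscale_mod`). [cite: AroraBarakCC2009, §1.3] -/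
theorem derivLC : CodeFP (pairE (pairE unE unE) (rawE L)) (rawE L) (fun t => derivL (max t.1.1 2) t.1.2 t.2) := by
  -- context `((M, k), rows)`, item `j`
  have hM : CodeFP (pairE (pairE (pairE unE unE) (rawE L)) natE) natE (fun t => max t.1.1.1 2) := (maxTwoUnC.comp (fst _ _).fst'.fst' :)
  have hk : CodeFP (pairE (pairE (pairE unE unE) (rawE L)) natE) natE (fun t => t.1.1.2) := (natOfUn.comp (fst _ _).fst'.snd' :)
  have hjk : CodeFP (pairE (pairE (pairE unE unE) (rawE L)) natE) natE (fun t => t.2 + t.1.1.2) := (natAdd.comp ((snd _ _).pair hk) :)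
  -- the falling factorial `(j+k)(j+k-1)⋯(j+1) mod M⁺`
  have hfac : CodeFP (pairE (pairE (pairE unE unE) (rawE L)) natE) intE
      (fun t => prodModZ (max t.1.1.1 2) ((List.range t.1.1.2).map fun i => ((t.2 + t.1.1.2 - i : ℕ) : ℤ))) := by
    have hi : CodeFP (pairE (pairE (pairE (pairE unE unE) (rawE L)) natE) natE) intE (fun t => ((t.1.2 + t.1.1.1.2 - t.2 : ℕ) : ℤ)) :=
      (intOfNat.comp (natSub.comp ((natAdd.comp ((fst _ _).snd'.pair (natOfUn.comp (fst _ _).fst'.fst'.snd'))).pair (snd _ _))) :)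
    exact (prodModZC.comp ((fst _ _).fst'.fst'.pair ((map hi).comp ((CodeFP.id _).pair (urange.comp (fst _ _).fst'.snd')))) :)
  have hrow : CodeFP (pairE (pairE (pairE unE unE) (rawE L)) natE) L (fun t => t.1.2.getD (t.2 + t.1.1.2) []) :=
    ((rawGetOr L).comp ((fst _ _).snd'.pair (hjk.pair (const _ ([] : List ℤ)))) :)
  have hitem : CodeFP (pairE (pairE (pairE unE unE) (rawE L)) natE) L
      (fun t => pmod (max t.1.1.1 2) (pscale (prodModZ (max t.1.1.1 2) ((List.range t.1.1.2).map fun i => ((t.2 + t.1.1.2 - i : ℕ) : ℤ))) (t.1.2.getD (t.2 + t.1.1.2) []))) :=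
    (pmodC.comp (hM.pair (pscaleC.comp (hfac.pair hrow))) :)
  have hlen : CodeFP (pairE (pairE unE unE) (rawE L)) unE (fun t => t.2.length - t.1.2) :=
    (unSubLen unitE).comp (((ulength L).comp (snd _ _)).pair (replicateUnit.comp (fst _ _).snd')) |>.congr fun t => by simp
  refine ((map hitem).comp ((CodeFP.id _).pair (urange.comp hlen))).congr fun t => ?_
  obtain ⟨⟨M, k⟩, rows⟩ := t
  simp only [derivL, id]
  refine List.map_congr_left fun j _ => ?_
  rw [prodModZ_eq, ← descFactorial_eq_prod, pmod_pscale_mod]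

/-- **The Newton denominator on codes**: `(M, R, v) ↦ deltaL M⁺ R v`. [cite: AroraBarakCC2009, §1.3] -/
theorem deltaLC : CodeFP (pairE unE (pairE (rawE L) intE)) intE (fun t => deltaL (max t.1 2) t.2.1 t.2.2) := by
  have hder : CodeFP (pairE unE (pairE (rawE L) intE)) (rawE L) (fun t => derivL (max t.1 2) 1 t.2.1) :=
    (derivLC.comp (((fst _ _).pair (const _ 1)).pair (snd _ _).fst') :)
  have hheads : CodeFP (pairE unE (pairE (rawE L) intE)) L (fun t => (derivL (max t.1 2) 1 t.2.1).map fun r => r.getD 0 0) :=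
    ((map₀ ((rawGetOr intE).comp ((CodeFP.id L).pair ((const _ 0).pair (const _ (0 : ℤ)))))).comp hder :)
  exact (hornerZC.comp ((fst _ _).pair (hheads.pair (snd _ _).snd'))).congr fun _ => rfl

/-! ### The core of the decoder -/

/-- The code of the core's input `((M, n), (I, J), w, μ, β, v)`. [folklore] -/
local notation "CORE" => pairE (pairE unE unE) (pairE (pairE unE unE) (pairE L (pairE unE (pairE natE natE))))

/-- **The core of the decoder on codes**: `((M, n), (I, J), w, μ, β, v) ↦ decodeCoreL M⁺ n I J w μ β v`
(`M, n, I, J, μ` unary). [cite: Hirahara2018, Thm. 4.7 (decoding)] [cite: AroraBarakCC2009, §1.3] -/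
theorem decodeCoreLC : CodeFP CORE strE
    (fun t => decodeCoreL (max t.1.1 2) t.1.2 t.2.1.1 t.2.1.2 t.2.2.1 t.2.2.2.1 t.2.2.2.2.1 t.2.2.2.2.2) := by
  have hM : CodeFP CORE unE (fun t => t.1.1) := ((fst _ _).fst' :)
  have hn : CodeFP CORE unE (fun t => t.1.2) := ((fst _ _).snd' :)
  have hμ : CodeFP CORE unE (fun t => t.2.2.2.1) := ((snd _ _).snd'.snd'.fst' :)
  have hβ : CodeFP CORE intE (fun t => (t.2.2.2.2.1 : ℤ)) := (intOfNat.comp (snd _ _).snd'.snd'.snd'.fst' :)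
  have hv : CodeFP CORE intE (fun t => (t.2.2.2.2.2 : ℤ)) := (intOfNat.comp (snd _ _).snd'.snd'.snd'.snd' :)
  have htab : CodeFP CORE (rawE L) (fun t => tabL t.2.1.1 t.2.1.2 t.2.2.1) := (tabLC.comp ((snd _ _).fst'.pair (snd _ _).snd'.fst') :)
  have hμ1 : CodeFP CORE unE (fun t => t.2.2.2.1 - 1) :=
    ((unSubLen unitE).comp (hμ.pair (const _ [()]))).congr fun t => by simp
  have hder : CodeFP CORE (rawE L) (fun t => derivL (max t.1.1 2) (t.2.2.2.1 - 1) (tabL t.2.1.1 t.2.1.2 t.2.2.1)) :=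
    (derivLC.comp ((hM.pair hμ1).pair htab) :)
  have hR : CodeFP CORE (rawE L)
      (fun t => (derivL (max t.1.1 2) (t.2.2.2.1 - 1) (tabL t.2.1.1 t.2.1.2 t.2.2.1)).map (shiftL (max t.1.1 2) (t.2.2.2.2.1 : ℤ))) :=
    ((map (shiftLC.comp ((fst _ _).fst'.pair ((fst _ _).snd'.pair (snd _ _))))).comp ((hM.pair hβ).pair hder) :)
  have hδinv : CodeFP CORE intE (fun t => invMod (max t.1.1 2)
      (deltaL (max t.1.1 2) ((derivL (max t.1.1 2) (t.2.2.2.1 - 1) (tabL t.2.1.1 t.2.1.2 t.2.2.1)).map (shiftL (max t.1.1 2) (t.2.2.2.2.1 : ℤ))) t.2.2.2.2.2)) :=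
    (invModC.comp (hM.pair (deltaLC.comp (hM.pair (hR.pair hv)))) :)
  have hg : CodeFP CORE L (fun t => newtonRunL (max t.1.1 2) t.1.2
      ((derivL (max t.1.1 2) (t.2.2.2.1 - 1) (tabL t.2.1.1 t.2.1.2 t.2.2.1)).map (shiftL (max t.1.1 2) (t.2.2.2.2.1 : ℤ))) t.2.2.2.2.2
      (invMod (max t.1.1 2) (deltaL (max t.1.1 2) ((derivL (max t.1.1 2) (t.2.2.2.1 - 1) (tabL t.2.1.1 t.2.1.2 t.2.2.1)).map
        (shiftL (max t.1.1 2) (t.2.2.2.2.1 : ℤ))) t.2.2.2.2.2))) :=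
    (newtonRunLC.comp ((hM.pair hn).pair (hR.pair (hv.pair hδinv))) :)
  have hnegβ : CodeFP CORE intE (fun t => ((max t.1.1 2 : ℕ) : ℤ) - t.2.2.2.2.1) := (intSub.comp ((intOfNat.comp (maxTwoUnC.comp hM)).pair hβ) :)
  have hback : CodeFP CORE L (fun t => shiftL (max t.1.1 2) (((max t.1.1 2 : ℕ) : ℤ) - t.2.2.2.2.1) (newtonRunL (max t.1.1 2) t.1.2
      ((derivL (max t.1.1 2) (t.2.2.2.1 - 1) (tabL t.2.1.1 t.2.1.2 t.2.2.1)).map (shiftL (max t.1.1 2) (t.2.2.2.2.1 : ℤ))) t.2.2.2.2.2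
      (invMod (max t.1.1 2) (deltaL (max t.1.1 2) ((derivL (max t.1.1 2) (t.2.2.2.1 - 1) (tabL t.2.1.1 t.2.1.2 t.2.2.1)).map
        (shiftL (max t.1.1 2) (t.2.2.2.2.1 : ℤ))) t.2.2.2.2.2)))) :=
    (shiftLC.comp (hM.pair (hnegβ.pair hg)) :)
  -- reading the bits
  have hbit : CodeFP (pairE L natE) bitE (fun t => decide (t.1.getD t.2 0 = 1)) :=
    (intEq.comp (((rawGetOr intE).comp ((fst _ _).pair ((snd _ _).pair (const _ (0 : ℤ))))).pair (const _ (1 : ℤ))) :)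
  have hread : CodeFP (pairE unE L) strE (fun t => readBitsL t.1 t.2) :=
    (rawToStr.comp ((map hbit).comp ((snd _ _).pair (urange.comp (fst _ _))))).congr fun _ => rfl
  exact (hread.comp (hn.pair hback)).congr fun t => by simp only [decodeCoreL]


/-! ### The parameters `b`, `q` and the unit budget -/

/-- The master unit budget `(n + e + 2)^{48}`: every numeral converted to unary below is at most this.
[cite: AroraBarakCC2009, §1.3 (polynomial budgets)] -/
def capOf (n e : ℕ) : ℕ := (n + e + 2) ^ 48

/-- `e⁴ (n+1) ≤ (n+e+2)⁵`. [folklore] -/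
theorem pow_four_mul_le (n e : ℕ) : e ^ 4 * (n + 1) ≤ (n + e + 2) ^ 5 := by
  have h1 : e ^ 4 ≤ (n + e + 2) ^ 4 := Nat.pow_le_pow_left (by omega) 4
  calc e ^ 4 * (n + 1) ≤ (n + e + 2) ^ 4 * (n + e + 2) := Nat.mul_le_mul h1 (by omega)
    _ = (n + e + 2) ^ 5 := (pow_succ _ 4).symm

/-- `b ≤ (n+e+2)⁶`. [folklore] -/
theorem bOf_le (n e : ℕ) : bOf n e ≤ (n + e + 2) ^ 6 := by
  have h1 : Nat.log 2 (e ^ 4 * (n + 1)) ≤ (n + e + 2) ^ 5 := ((Nat.log_le_self 2 _).trans (pow_four_mul_le n e) :)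
  have h2 : 13 ≤ (n + e + 2) ^ 5 := by
    calc 13 ≤ 2 ^ 5 := by norm_num
      _ ≤ (n + e + 2) ^ 5 := Nat.pow_le_pow_left (by omega) 5
  have h3 : 2 * (n + e + 2) ^ 5 ≤ (n + e + 2) ^ 6 := by
    calc 2 * (n + e + 2) ^ 5 ≤ (n + e + 2) * (n + e + 2) ^ 5 := Nat.mul_le_mul_right _ (by omega)
      _ = (n + e + 2) ^ 6 := (pow_succ' _ 5).symm
  rw [bOf]; omega

/-- `2^b ≤ (n+e+2)^{18}`. [folklore] -/
theorem two_pow_bOf_le (n e : ℕ) : 2 ^ bOf n e ≤ (n + e + 2) ^ 18 := by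
  rw [bOf, pow_add]
  have h1 : 2 ^ Nat.log 2 (e ^ 4 * (n + 1)) ≤ (n + e + 2) ^ 5 := by
    rcases Nat.eq_zero_or_pos (e ^ 4 * (n + 1)) with h0 | hpos
    · rw [h0, Nat.log_zero_right, pow_zero]; exact Nat.one_le_pow _ _ (by omega)
    · exact (Nat.pow_log_le_self 2 hpos.ne').trans (pow_four_mul_le n e)
  have h2 : (2 : ℕ) ^ 13 ≤ (n + e + 2) ^ 13 := Nat.pow_le_pow_left (by omega) 13
  calc 2 ^ Nat.log 2 (e ^ 4 * (n + 1)) * 2 ^ 13 ≤ (n + e + 2) ^ 5 * (n + e + 2) ^ 13 := Nat.mul_le_mul h1 h2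
    _ = (n + e + 2) ^ 18 := (pow_add _ 5 13).symm

/-- Powers of the base are monotone in the exponent (base `≥ 2`). [folklore] -/
theorem base_pow_mono (n e : ℕ) {i j : ℕ} (h : i ≤ j) : (n + e + 2) ^ i ≤ (n + e + 2) ^ j :=
  Nat.pow_le_pow_right (by omega) h

/-- `b ≤ cap`. [folklore] -/
theorem bOf_le_capOf (n e : ℕ) : bOf n e ≤ capOf n e := (bOf_le n e).trans (base_pow_mono n e (by norm_num))

/-- `2^b + 1 ≤ cap`. [folklore] -/
theorem two_pow_bOf_succ_le_capOf (n e : ℕ) : 2 ^ bOf n e + 1 ≤ capOf n e := by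
  have h1 := two_pow_bOf_le n e
  have h2 : (n + e + 2) ^ 18 + 1 ≤ 2 * (n + e + 2) ^ 18 := by have := Nat.one_le_pow 18 (n + e + 2) (by omega); omega
  have h3 : 2 * (n + e + 2) ^ 18 ≤ (n + e + 2) ^ 19 := by
    calc 2 * (n + e + 2) ^ 18 ≤ (n + e + 2) * (n + e + 2) ^ 18 := Nat.mul_le_mul_right _ (by omega)
      _ = (n + e + 2) ^ 19 := (pow_succ' _ 18).symm
  exact (Nat.succ_le_succ h1).trans (h2.trans (h3.trans (base_pow_mono n e (by norm_num))))

/-- `(2^b)² ≤ cap`. [folklore] -/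
theorem two_pow_bOf_sq_le_capOf (n e : ℕ) : 2 ^ bOf n e * 2 ^ bOf n e ≤ capOf n e := by
  calc 2 ^ bOf n e * 2 ^ bOf n e ≤ (n + e + 2) ^ 18 * (n + e + 2) ^ 18 := Nat.mul_le_mul (two_pow_bOf_le n e) (two_pow_bOf_le n e)
    _ = (n + e + 2) ^ 36 := (pow_add _ 18 18).symm
    _ ≤ capOf n e := base_pow_mono n e (by norm_num)

/-- `#pts ≤ (2^b)²` on every input. [folklore] -/
theorem length_ptsL_le_sq (b e q : ℕ) (r : List Bool) : (ptsL b e q r).length ≤ 2 ^ b * 2 ^ b := by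
  rw [ptsL, List.length_flatten, List.map_map]
  have h : ∀ x ∈ (List.range (2 ^ b)).map (List.length ∘ fun α => (candL b e r α).map fun v => (α % q, v)), x ≤ 2 ^ b := by
    intro x hx
    obtain ⟨α, -, rfl⟩ := List.mem_map.1 hx
    simp only [Function.comp_apply, List.length_map, candL]
    exact (List.length_filter_le _ _).trans (by simp)
  exact (List.sum_le_card_nsmul _ _ h).trans (by simp)

/-- `J ≤ (n+e+2)⁷`. [folklore] -/
theorem JOf_le (n e : ℕ) : JOf e ≤ (n + e + 2) ^ 7 := by
  rw [JOf]
  calc 16 * e ^ 3 ≤ (n + e + 2) ^ 4 * (n + e + 2) ^ 3 :=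
        Nat.mul_le_mul ((show 16 = 2 ^ 4 by norm_num) ▸ Nat.pow_le_pow_left (by omega) 4) (Nat.pow_le_pow_left (by omega) 3)
    _ = (n + e + 2) ^ 7 := (pow_add _ 4 3).symm

/-- `I · J ≤ cap` on every input. [folklore] -/
theorem IJ_le_capOf (n e : ℕ) (r : List Bool) :
    IOf (ptsL (bOf n e) e (qOf n e) r).length (JOf e) * JOf e ≤ capOf n e := by
  have hP := (length_ptsL_le_sq (bOf n e) e (qOf n e) r).trans
    ((Nat.mul_le_mul (two_pow_bOf_le n e) (two_pow_bOf_le n e)).trans_eq (pow_add _ 18 18).symm)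
  have hI : IOf (ptsL (bOf n e) e (qOf n e) r).length (JOf e) ≤ (n + e + 2) ^ 36 + 1 := Nat.succ_le_succ ((Nat.div_le_self _ _).trans hP)
  have h1 : (n + e + 2) ^ 36 + 1 ≤ (n + e + 2) ^ 37 := by
    have := Nat.one_le_pow 36 (n + e + 2) (by omega)
    calc (n + e + 2) ^ 36 + 1 ≤ 2 * (n + e + 2) ^ 36 := by omega
      _ ≤ (n + e + 2) * (n + e + 2) ^ 36 := Nat.mul_le_mul_right _ (by omega)
      _ = (n + e + 2) ^ 37 := (pow_succ' _ 36).symm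
  calc IOf (ptsL (bOf n e) e (qOf n e) r).length (JOf e) * JOf e ≤ (n + e + 2) ^ 37 * (n + e + 2) ^ 7 :=
        Nat.mul_le_mul (hI.trans h1) (JOf_le n e)
    _ = (n + e + 2) ^ 44 := (pow_add _ 37 7).symm
    _ ≤ capOf n e := base_pow_mono n e (by norm_num)

/-- `J ≤ cap`. [folklore] -/
theorem JOf_le_capOf (n e : ℕ) : JOf e ≤ capOf n e := (JOf_le n e).trans (base_pow_mono _ _ (by norm_num))

/-- `1 ≤ cap`. [folklore] -/
theorem one_le_capOf (n e : ℕ) : 1 ≤ capOf n e := Nat.one_le_pow _ _ (by omega)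

-- From here on the parameters are treated as opaque numerals: unfolding `bOf` (`… + 13`) or `capOf`
-- (`(n+e+2)^48`) inside a definitional-equality check makes `whnf` build astronomically large
-- `Nat.add` trees; every identity below is proved by rewriting instead.
attribute [local irreducible] bOf capOf JOf DOf IOf

/-- The code of `(e, n)`. [folklore] -/
local notation "EN" => pairE unE unE

/-- The unit budget on codes. [cite: AroraBarakCC2009, §1.3] -/
theorem capUC : CodeFP EN unE (fun p => capOf p.2 p.1) :=
  ((unPowC 48).comp (unAdd.comp ((unAdd.comp ((snd _ _).pair (fst _ _))).pair (const _ 2)))).congr fun p => by rw [capOf]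

/-- **`b = bOf n e` on codes** (binary). [cite: Hirahara2018, Thm. 4.7 (`ℓ = O(log(n/ε))`)] -/
theorem bOfC : CodeFP EN natE (fun p => bOf p.2 p.1) :=
  (natAdd.comp ((natLog2.comp (natMul.comp (((natPowC 4).comp (natOfUn.comp (fst _ _))).pair
    (natOfUn.comp (unSucc.comp (snd _ _)))))).pair (const _ 13))).congr fun p => by rw [bOf]; rfl

/-- `b` in unary. [folklore] -/
theorem bOfUC : CodeFP EN unE (fun p => bOf p.2 p.1) := unOfNat_of_le bOfC capUC fun p => bOf_le_capOf p.2 p.1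

/-- `B = 2^b` in binary. [folklore] -/
theorem twoPowBC : CodeFP EN natE (fun p => 2 ^ bOf p.2 p.1) := (natPow.comp ((const _ 2).pair bOfUC) :)

/-- `B = 2^b` in unary. [folklore] -/
theorem twoPowBUC : CodeFP EN unE (fun p => 2 ^ bOf p.2 p.1) :=
  unOfNat_of_le twoPowBC capUC fun p => (Nat.le_succ _).trans (two_pow_bOf_succ_le_capOf p.2 p.1)

/-- `2^{b-1}` in binary. [folklore] -/
theorem halfBC : CodeFP EN natE (fun p => 2 ^ (bOf p.2 p.1 - 1)) := by
  have h1 : CodeFP EN unE (fun p => bOf p.2 p.1 - 1) := ((unSubLen unitE).comp (bOfUC.pair (const _ [()]))).congr fun p => by simp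
  exact (natPow.comp ((const _ 2).pair h1) :)

/-- **The prime `q` by trial division**: the first `p ≤ 2^b` with `2^{b-1} < p` prime (the primality
test is run on `min p 2^b` in unary). [cite: AroraBarakCC2009, §19.3 (a prime field of the right size)] -/
def qSearch (b : ℕ) : ℕ :=
  (((List.range (2 ^ b + 1)).find? fun p => Nat.blt (2 ^ (b - 1)) p && isPrimeTD (min p (2 ^ b))).getD 0)

/-- **`qSearch (bOf n e) = qOf n e`** (`qOf` is the least prime above `2^{b-1}`, and it is `≤ 2^b`). [folklore] -/
theorem qSearch_eq (n e : ℕ) : qSearch (bOf n e) = qOf n e := by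
  have hfind : ((List.range (2 ^ bOf n e + 1)).find? fun p => Nat.blt (2 ^ (bOf n e - 1)) p && isPrimeTD (min p (2 ^ bOf n e))) =
      some (qOf n e) := by
    rw [List.find?_range_eq_some]
    refine ⟨?_, List.mem_range.2 (Nat.lt_succ_of_le (qOf_le_two_pow n e)), fun j hj => ?_⟩
    · have hP : (Nat.blt (2 ^ (bOf n e - 1)) (qOf n e) && isPrimeTD (min (qOf n e) (2 ^ bOf n e))) = true := by
        rw [min_eq_left (qOf_le_two_pow n e)]
        have h1 : Nat.blt (2 ^ (bOf n e - 1)) (qOf n e) = true := by rw [Nat.blt_eq]; exact two_pow_lt_qOf n e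
        have h2 := (isPrimeTD_iff _).2 (qOf_prime n e)
        simp [h1, h2]
      simpa using hP
    · have hP : (Nat.blt (2 ^ (bOf n e - 1)) j && isPrimeTD (min j (2 ^ bOf n e))) = false := by
        by_cases h : 2 ^ (bOf n e - 1) < j
        · rw [min_eq_left (hj.le.trans (qOf_le_two_pow n e))]
          have hnp := not_prime_of_lt_qOf n e h hj
          rw [← isPrimeTD_iff] at hnp
          simp [hnp]
        · have : Nat.blt (2 ^ (bOf n e - 1)) j = false := by rw [← Bool.not_eq_true, Nat.blt_eq]; exact h
          simp [this]
      simp [hP]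
  rw [qSearch, hfind, Option.getD_some]

/-- **`q = qOf n e` on codes** (binary). [cite: AroraBarakCC2009, §1.3, §19.3] -/
theorem qOfC : CodeFP EN natE (fun p => qOf p.2 p.1) := by
  -- the candidate test, context `(e, n)`, item `p`
  have hblt : CodeFP (pairE natE natE) bitE (fun p => Nat.blt p.1 p.2) := natLt.congr fun p => by
    rw [Bool.eq_iff_iff, decide_eq_true_iff, Nat.blt_eq]
  have htest : CodeFP (pairE EN natE) bitE (fun t => Nat.blt (2 ^ (bOf t.1.2 t.1.1 - 1)) t.2 && isPrimeTD (min t.2 (2 ^ bOf t.1.2 t.1.1))) :=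
    ((hblt.comp ((halfBC.comp (fst _ _)).pair (snd _ _))).and (isPrimeTDC.comp (unOfNatMin.comp ((twoPowBUC.comp (fst _ _)).pair (snd _ _)))) :)
  have hfind := (rawFind? htest).comp ((CodeFP.id EN).pair (urange.comp (unSucc.comp twoPowBUC)))
  have hget := optCases (σ := ℕ × ℕ) (α := ℕ) (δ := ℕ) (eσ := EN) (eα := natE) (eδ := natE) (k := fun _ o => o.getD 0)
    (gnone := fun _ => 0) (gsome := fun q => q.2) (const _ 0) (snd _ _) (fun _ => rfl) (fun _ _ => rfl)
  refine (hget.comp ((CodeFP.id EN).pair hfind)).congr fun p => ?_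
  exact qSearch_eq p.2 p.1

/-- `q` in unary. [folklore] -/
theorem qOfUC : CodeFP EN unE (fun p => qOf p.2 p.1) :=
  unOfNat_of_le qOfC capUC fun p => (qOf_le_two_pow p.2 p.1).trans ((Nat.le_succ _).trans (two_pow_bOf_succ_le_capOf p.2 p.1))

/-! ### The Hadamard bit and the inner lists -/

/-- The Hadamard bit as the parity of a list count. [cite: AroraBarakCC2009, §19.3 (Walsh–Hadamard code)] -/
def hadL (b v y : ℕ) : ℕ := ((List.range b).filter fun k => v.testBit k && y.testBit k).length % 2

/-- `hadN b v y = [hadL b v y = 1]`. [folklore] -/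
theorem hadN_eq_decide (b v y : ℕ) : hadN b v y = decide (hadL b v y = 1) := by
  rw [hadN, hadL, length_filter_range]
  have hc : (Finset.univ.filter fun k : Fin b => v.testBit k && y.testBit k).card =
      ((Finset.range b).filter fun k => v.testBit k && y.testBit k).card := by
    rw [Finset.card_filter, Finset.card_filter]
    exact Fin.sum_univ_eq_sum_range (fun k => if (v.testBit k && y.testBit k) = true then 1 else 0) b
  rw [hc, Nat.mod_two_of_bodd]
  cases Nat.bodd ((Finset.range b).filter fun k => v.testBit k && y.testBit k).card <;> simp

/-- Bit test by division (twin of `GF2X.natTestBitFP`, `InformationTheory/Coding/GF2XArithFP.lean`, outside this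
import cone). [folklore] -/
theorem testBitC : CodeFP (pairE natE unE) bitE (fun p => p.1.testBit p.2) :=
  (natEq.comp ((natMod.comp ((natDiv.comp ((fst _ _).pair (natPow.comp ((const _ 2).pair (snd _ _))))).pair (const _ 2))).pair
    (const _ 1))).congr fun p => by rw [Nat.testBit_eq_decide_div_mod_eq]

/-- **The Hadamard parity on codes**: `(b, v, y) ↦ hadL b v y` (`b` unary). [cite: AroraBarakCC2009, §1.3, §19.3] -/
theorem hadLC : CodeFP (pairE unE (pairE natE natE)) natE (fun t => hadL t.1 t.2.1 t.2.2) := by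
  -- item `k < b` in binary, converted to unary under the cap `b`
  have hk : CodeFP (pairE (pairE unE (pairE natE natE)) natE) unE (fun t => min t.2 t.1.1) := (unOfNatMin.comp ((fst _ _).fst'.pair (snd _ _)) :)
  have htest : CodeFP (pairE (pairE unE (pairE natE natE)) natE) bitE (fun t => t.1.2.1.testBit (min t.2 t.1.1) && t.1.2.2.testBit (min t.2 t.1.1)) :=
    ((testBitC.comp ((fst _ _).snd'.fst'.pair hk)).and (testBitC.comp ((fst _ _).snd'.snd'.pair hk)) :)
  have hfil := (filter htest).comp ((CodeFP.id _).pair (urange.comp (fst _ _)))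
  refine ((natMod.comp (((natLength natE).comp hfil).pair (const _ 2))).congr fun t => ?_)
  obtain ⟨b, v, y⟩ := t
  simp only [hadL, id]
  congr 2
  exact List.filter_congr fun k hk => by rw [min_eq_left (List.mem_range.1 hk).le]

/-- The code of the decoder's data `(e, n, r)`. [folklore] -/
local notation "ENR" => pairE unE (pairE unE strE)

/-- `(e, n)` of `(e, n, r)`. [folklore] -/
theorem enOfENR : CodeFP ENR EN (fun t => (t.1, t.2.1)) := ((fst _ _).pair (snd _ _).fst' :)

/-- **Block agreements on codes**: `((e, n, r), α, v) ↦ blockAgreeL b r α v` with `b = bOf n e`.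
[cite: AroraBarakCC2009, §1.3, §19.4] -/
theorem blockAgreeLC : CodeFP (pairE ENR (pairE natE natE)) natE (fun t => blockAgreeL (bOf t.1.2.1 t.1.1) t.1.2.2 t.2.1 t.2.2) := by
  -- context `((e,n,r), α, v)`, item `y`
  have hb : CodeFP (pairE (pairE ENR (pairE natE natE)) natE) unE (fun t => bOf t.1.1.2.1 t.1.1.1) := (bOfUC.comp (enOfENR.comp (fst _ _).fst') :)
  have hB : CodeFP (pairE (pairE ENR (pairE natE natE)) natE) natE (fun t => 2 ^ bOf t.1.1.2.1 t.1.1.1) := (twoPowBC.comp (enOfENR.comp (fst _ _).fst') :)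
  have hidx : CodeFP (pairE (pairE ENR (pairE natE natE)) natE) natE (fun t => t.1.2.1 * 2 ^ bOf t.1.1.2.1 t.1.1.1 + t.2) :=
    (natAdd.comp ((natMul.comp ((fst _ _).snd'.fst'.pair hB)).pair (snd _ _)) :)
  have hbit : CodeFP (pairE (pairE ENR (pairE natE natE)) natE) bitE (fun t => t.1.1.2.2.getD (t.1.2.1 * 2 ^ bOf t.1.1.2.1 t.1.1.1 + t.2) false) :=
    (strGetD'.comp ((fst _ _).fst'.snd'.snd'.pair hidx) :)
  have hhad : CodeFP (pairE (pairE ENR (pairE natE natE)) natE) bitE (fun t => hadN (bOf t.1.1.2.1 t.1.1.1) t.1.2.2 t.2) :=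
    (natEq.comp ((hadLC.comp (hb.pair ((fst _ _).snd'.snd'.pair (snd _ _)))).pair (const _ 1))).congr fun t => by rw [hadN_eq_decide]
  have htest : CodeFP (pairE (pairE ENR (pairE natE natE)) natE) bitE
      (fun t => t.1.1.2.2.getD (t.1.2.1 * 2 ^ bOf t.1.1.2.1 t.1.1.1 + t.2) false == hadN (bOf t.1.1.2.1 t.1.1.1) t.1.2.2 t.2) :=
    ((beq bitE_injective).comp (hbit.pair hhad) :)
  have hfil := (filter htest).comp ((CodeFP.id _).pair (urange.comp (twoPowBUC.comp (enOfENR.comp (fst _ _)))))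
  exact ((natLength natE).comp hfil).congr fun _ => rfl

/-- **The inner lists on codes**: `((e, n, r), α) ↦ candL b e r α`. [cite: AroraBarakCC2009, §1.3, §19.4] -/
theorem candLC : CodeFP (pairE ENR natE) (rawE natE) (fun t => candL (bOf t.1.2.1 t.1.1) t.1.1 t.1.2.2 t.2) := by
  -- context `((e,n,r), α)`, item `v`
  have hB : CodeFP (pairE (pairE ENR natE) natE) natE (fun t => 2 ^ bOf t.1.1.2.1 t.1.1.1) := (twoPowBC.comp (enOfENR.comp (fst _ _).fst') :)
  have hD : CodeFP (pairE (pairE ENR natE) natE) natE (fun t => DOf (bOf t.1.1.2.1 t.1.1.1) t.1.1.1) :=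
    (natDiv.comp (hB.pair (natOfUn.comp (fst _ _).fst'.fst'))).congr fun t => by rw [DOf]; rfl
  have hagr : CodeFP (pairE (pairE ENR natE) natE) natE (fun t => blockAgreeL (bOf t.1.1.2.1 t.1.1.1) t.1.1.2.2 t.1.2 t.2) :=
    (blockAgreeLC.comp ((fst _ _).fst'.pair ((fst _ _).snd'.pair (snd _ _))) :)
  have hble : CodeFP (pairE natE natE) bitE (fun p => Nat.ble p.1 p.2) := natLe.congr fun p => by
    rw [Bool.eq_iff_iff, decide_eq_true_iff, Nat.ble_eq]
  have htest : CodeFP (pairE (pairE ENR natE) natE) bitE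
      (fun t => Nat.ble (2 ^ bOf t.1.1.2.1 t.1.1.1 + DOf (bOf t.1.1.2.1 t.1.1.1) t.1.1.1) (2 * blockAgreeL (bOf t.1.1.2.1 t.1.1.1) t.1.1.2.2 t.1.2 t.2)) :=
    (hble.comp ((natAdd.comp (hB.pair hD)).pair ((natMulC 2).comp hagr)) :)
  exact ((filter htest).comp ((CodeFP.id _).pair (urange.comp (twoPowBUC.comp (enOfENR.comp (fst _ _)))))).congr fun _ => rfl

/-- **The interpolation points on codes**: `(e, n, r) ↦ ptsL b e q r`. [cite: AroraBarakCC2009, §1.3, §19] -/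
theorem ptsLC : CodeFP ENR (rawE (pairE natE natE)) (fun t => ptsL (bOf t.2.1 t.1) t.1 (qOf t.2.1 t.1) t.2.2) := by
  -- context `((e,n,r), α)`, item `v ↦ (α mod q, v)`
  have hpt : CodeFP (pairE (pairE ENR natE) natE) (pairE natE natE) (fun t => (t.1.2 % qOf t.1.1.2.1 t.1.1.1, t.2)) :=
    ((natMod.comp ((fst _ _).snd'.pair (qOfC.comp (enOfENR.comp (fst _ _).fst')))).pair (snd _ _) :)
  have hblock : CodeFP (pairE ENR natE) (rawE (pairE natE natE))
      (fun t => (candL (bOf t.1.2.1 t.1.1) t.1.1 t.1.2.2 t.2).map fun v => (t.2 % qOf t.1.2.1 t.1.1, v)) :=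
    ((map hpt).comp ((CodeFP.id _).pair candLC) :)
  exact (((flatten (pairE natE natE)).comp ((map hblock).comp ((CodeFP.id _).pair (urange.comp (twoPowBUC.comp enOfENR)))))).congr
    fun _ => rfl

/-! ### Sudan's linear system on codes -/

/-- `J = 16 e³` on `(e, n, r)`, binary and unary. [folklore] -/
theorem JOfC : CodeFP ENR natE (fun t => JOf t.1) := ((natMulC 16).comp ((natPowC 3).comp (natOfUn.comp (fst _ _)))).congr fun t => by rw [JOf]; rfl

/-- `I` on `(e, n, r)`, in unary. [folklore] -/
theorem IOfUC : CodeFP ENR unE (fun t => IOf (ptsL (bOf t.2.1 t.1) t.1 (qOf t.2.1 t.1) t.2.2).length (JOf t.1)) := by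
  have hI : CodeFP ENR natE (fun t => IOf (ptsL (bOf t.2.1 t.1) t.1 (qOf t.2.1 t.1) t.2.2).length (JOf t.1)) :=
    (natAdd.comp ((natDiv.comp (((natLength (pairE natE natE)).comp ptsLC).pair JOfC)).pair (const _ 1))).congr fun t => by rw [IOf]
  refine unOfNat_of_le hI (capUC.comp enOfENR) fun t => ?_
  have h := IJ_le_capOf t.2.1 t.1 t.2.2
  have hJ : 1 ≤ JOf t.1 ∨ JOf t.1 = 0 := by omega
  rcases hJ with hJ | hJ
  · exact (Nat.le_mul_of_pos_right _ hJ).trans h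
  · -- `J = 0`: then `I = 1`
    rw [hJ, IOf, Nat.div_zero]
    exact one_le_capOf _ _

/-- `J` on `(e, n, r)`, in unary. [folklore] -/
theorem JOfUC : CodeFP ENR unE (fun t => JOf t.1) :=
  unOfNat_of_le JOfC (capUC.comp enOfENR) fun t => JOf_le_capOf t.2.1 t.1

/-- `I · J` on `(e, n, r)`, in unary. [folklore] -/
theorem IJUC : CodeFP ENR unE (fun t => IOf (ptsL (bOf t.2.1 t.1) t.1 (qOf t.2.1 t.1) t.2.2).length (JOf t.1) * JOf t.1) :=
  (unMul.comp (IOfUC.pair JOfUC) :)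

/-- `powMod` computes the reduced power for `q ≥ 2`. [folklore] -/
theorem powMod_eq_pow_mod {q : ℕ} (hq : 2 ≤ q) (a i : ℕ) : powMod q (a : ℤ) i = ((a ^ i % q : ℕ) : ℤ) := by
  have hq0 : 0 < q := by omega
  have h1 : 0 ≤ powMod q (a : ℤ) i ∧ powMod q (a : ℤ) i < q := by
    rcases powMod_bounds' hq0 (a : ℤ) i with h | h
    · exact h
    · rw [h]; exact ⟨zero_le_one, by exact_mod_cast hq⟩
  have h2 : (0 : ℤ) ≤ ((a ^ i % q : ℕ) : ℤ) ∧ ((a ^ i % q : ℕ) : ℤ) < q := ⟨by positivity, by exact_mod_cast Nat.mod_lt _ hq0⟩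
  refine eq_of_cast_eq_of_reduced h1 h2 ?_
  rw [cast_powMod, Int.cast_natCast, Int.cast_natCast, ZMod.natCast_mod, Nat.cast_pow]

/-- **A row of Sudan's system on codes**: `(((q, I), I·J), (β, v)) ↦` the row of `rowL q I J (β, v)` computed
with `powMod` (`q, I, I·J` unary; exponents `k mod I`, `k / I ≤ I·J` in unary). [cite: AroraBarakCC2009, §1.3, §19] -/
theorem rowLC' : CodeFP (pairE (pairE (pairE unE unE) unE) (pairE natE natE)) L
    (fun t => (List.range t.1.2).map fun k =>
      (powMod (max t.1.1.1 2) (t.2.1 : ℤ) (min (k % t.1.1.2) t.1.2)) * (powMod (max t.1.1.1 2) (t.2.2 : ℤ) (min (k / t.1.1.2) t.1.2)) % ((max t.1.1.1 2 : ℕ) : ℤ)) := by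
  have hq : CodeFP (pairE (pairE (pairE (pairE unE unE) unE) (pairE natE natE)) natE) unE (fun t => t.1.1.1.1) := ((fst _ _).fst'.fst'.fst' :)
  have hI : CodeFP (pairE (pairE (pairE (pairE unE unE) unE) (pairE natE natE)) natE) natE (fun t => t.1.1.1.2) := (natOfUn.comp (fst _ _).fst'.fst'.snd' :)
  have hIJ : CodeFP (pairE (pairE (pairE (pairE unE unE) unE) (pairE natE natE)) natE) unE (fun t => t.1.1.2) := ((fst _ _).fst'.snd' :)
  have he1 : CodeFP (pairE (pairE (pairE (pairE unE unE) unE) (pairE natE natE)) natE) unE (fun t => min (t.2 % t.1.1.1.2) t.1.1.2) :=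
    (unOfNatMin.comp (hIJ.pair (natMod.comp ((snd _ _).pair hI))) :)
  have he2 : CodeFP (pairE (pairE (pairE (pairE unE unE) unE) (pairE natE natE)) natE) unE (fun t => min (t.2 / t.1.1.1.2) t.1.1.2) :=
    (unOfNatMin.comp (hIJ.pair (natDiv.comp ((snd _ _).pair hI))) :)
  have h1 : CodeFP (pairE (pairE (pairE (pairE unE unE) unE) (pairE natE natE)) natE) intE (fun t => powMod (max t.1.1.1.1 2) (t.1.2.1 : ℤ) (min (t.2 % t.1.1.1.2) t.1.1.2)) :=
    (powModC.comp (hq.pair ((intOfNat.comp (fst _ _).snd'.fst').pair he1)) :)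
  have h2 : CodeFP (pairE (pairE (pairE (pairE unE unE) unE) (pairE natE natE)) natE) intE (fun t => powMod (max t.1.1.1.1 2) (t.1.2.2 : ℤ) (min (t.2 / t.1.1.1.2) t.1.1.2)) :=
    (powModC.comp (hq.pair ((intOfNat.comp (fst _ _).snd'.snd').pair he2)) :)
  have hitem : CodeFP (pairE (pairE (pairE (pairE unE unE) unE) (pairE natE natE)) natE) intE
      (fun t => (powMod (max t.1.1.1.1 2) (t.1.2.1 : ℤ) (min (t.2 % t.1.1.1.2) t.1.1.2)) * (powMod (max t.1.1.1.1 2) (t.1.2.2 : ℤ) (min (t.2 / t.1.1.1.2) t.1.1.2)) %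
        ((max t.1.1.1.1 2 : ℕ) : ℤ)) :=
    (intEMod.comp ((intMul.comp (h1.pair h2)).pair (intOfNat.comp (maxTwoUnC.comp hq))) :)
  exact ((map hitem).comp ((CodeFP.id _).pair (urange.comp (fst _ _).snd'))).congr fun _ => rfl

/-- `rowL` through `powMod` for `q ≥ 2` (exponents capped by `I·J`, which they never reach). [folklore] -/
theorem rowL_eq_powMod {q : ℕ} (hq : 2 ≤ q) (I J : ℕ) (pt : ℕ × ℕ) :
    rowL q I J pt = (List.range (I * J)).map fun k =>
      (powMod q (pt.1 : ℤ) (min (k % I) (I * J))) * (powMod q (pt.2 : ℤ) (min (k / I) (I * J))) % (q : ℤ) := by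
  rw [rowL]
  refine List.map_congr_left fun k hk => ?_
  have hkIJ : k < I * J := List.mem_range.1 hk
  have h1 : k % I ≤ I * J := ((Nat.mod_le k I).trans hkIJ.le :)
  have h2 : k / I ≤ I * J := ((Nat.div_le_self k I).trans hkIJ.le :)
  rw [min_eq_left h1, min_eq_left h2, powMod_eq_pow_mod hq, powMod_eq_pow_mod hq]
  push_cast
  rfl

/-- **All rows on codes**: `(e, n, r) ↦ rowsL b e q r`. [cite: AroraBarakCC2009, §1.3, §19] -/
theorem rowsLC : CodeFP ENR (rawE L) (fun t => rowsL (bOf t.2.1 t.1) t.1 (qOf t.2.1 t.1) t.2.2) := by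
  have hctx : CodeFP ENR (pairE (pairE unE unE) unE)
      (fun t => ((qOf t.2.1 t.1, IOf (ptsL (bOf t.2.1 t.1) t.1 (qOf t.2.1 t.1) t.2.2).length (JOf t.1)),
        IOf (ptsL (bOf t.2.1 t.1) t.1 (qOf t.2.1 t.1) t.2.2).length (JOf t.1) * JOf t.1)) :=
    (((qOfUC.comp enOfENR).pair IOfUC).pair IJUC :)
  refine ((map rowLC').comp (hctx.pair ptsLC)).congr fun t => ?_
  have hq2 := (qOf_prime t.2.1 t.1).two_le
  simp only [rowsL]
  refine List.map_congr_left fun pt _ => ?_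
  rw [rowL_eq_powMod hq2, max_eq_left hq2]

/-- **The kernel vector on codes**: `(e, n, r) ↦ kerVecMod q (I·J) (rowsL b e q r)`. [cite: KnuthTAOCP2, §4.6.2, Algorithm N] [cite: AroraBarakCC2009, §1.3] -/
theorem kerVecC : CodeFP ENR (optE L)
    (fun t => kerVecMod (qOf t.2.1 t.1) (IOf (ptsL (bOf t.2.1 t.1) t.1 (qOf t.2.1 t.1) t.2.2).length (JOf t.1) * JOf t.1)
      (rowsL (bOf t.2.1 t.1) t.1 (qOf t.2.1 t.1) t.2.2)) :=
  (kerVecModC.comp ((qOfUC.comp enOfENR).pair (IJUC.pair rowsLC))).congr fun t => by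
    rw [max_eq_left (qOf_prime t.2.1 t.1).two_le]

/-! ### The whole decoder on codes -/

/-- The code of the decoder's input `(adv, e, n, r)`. [folklore] -/
local notation "AENR" => pairE strE (pairE unE (pairE unE strE))

/-- The three advice fields `(μ, β, v)` of `adv = ⟨bits μ, ⟨bits β, bits v⟩⟩`. [folklore] -/
def advFields (adv : List Bool) : ℕ × ℕ × ℕ := (bitsToNat (fstF adv), bitsToNat (fstF (sndF adv)), bitsToNat (sndF (sndF adv)))

/-- Reading the advice fields on codes. [folklore] -/
theorem advFieldsC : CodeFP strE (pairE natE (pairE natE natE)) advFields := by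
  have hf : CodeFP strE strE fstF := of_fn fstF fstF_mem_FP fun _ => rfl
  have hs : CodeFP strE strE sndF := of_fn sndF sndF_mem_FP fun _ => rfl
  exact ((strVal.comp hf).pair ((strVal.comp (hf.comp hs)).pair (strVal.comp (hs.comp hs)))).congr fun _ => rfl

/-- **The advised decoder on codes**: `(adv, e, n, r) ↦ decodeL e n r (min μ cap) β v` with
`(μ, β, v) = advFields adv` (the multiplicity is capped by the unit budget, which is the identity on
the advice of the correctness theorem). [cite: Hirahara2018, Thm. 4.7] [cite: AroraBarakCC2009, §1.3] -/
theorem decodeLC : CodeFP AENR strE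
    (fun t => decodeL t.2.1 t.2.2.1 t.2.2.2 (min (advFields t.1).1 (capOf t.2.2.1 t.2.1)) (advFields t.1).2.1 (advFields t.1).2.2) := by
  have henr : CodeFP AENR ENR (fun t => t.2) := snd _ _
  have hen : CodeFP AENR EN (fun t => (t.2.1, t.2.2.1)) := (enOfENR.comp henr :)
  have hadv : CodeFP AENR (pairE natE (pairE natE natE)) (fun t => advFields t.1) := (advFieldsC.comp (fst _ _) :)
  have hμ : CodeFP AENR unE (fun t => min (advFields t.1).1 (capOf t.2.2.1 t.2.1)) := (unOfNatMin.comp ((capUC.comp hen).pair hadv.fst') :)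
  -- the core's input from `(adv, e, n, r)` and a kernel vector `w`
  have hqn : CodeFP (pairE AENR L) (pairE unE unE) (fun s => (qOf s.1.2.2.1 s.1.2.1, s.1.2.2.1)) :=
    ((qOfUC.comp (hen.comp (fst _ _))).pair (fst _ _).snd'.snd'.fst' :)
  have hIJp : CodeFP (pairE AENR L) (pairE unE unE)
      (fun s => (IOf (ptsL (bOf s.1.2.2.1 s.1.2.1) s.1.2.1 (qOf s.1.2.2.1 s.1.2.1) s.1.2.2.2).length (JOf s.1.2.1), JOf s.1.2.1)) :=
    ((IOfUC.comp (henr.comp (fst _ _))).pair (JOfUC.comp (henr.comp (fst _ _))) :)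
  have hrest : CodeFP (pairE AENR L) (pairE L (pairE unE (pairE natE natE)))
      (fun s => (s.2, min (advFields s.1.1).1 (capOf s.1.2.2.1 s.1.2.1), (advFields s.1.1).2.1, (advFields s.1.1).2.2)) :=
    ((snd _ _).pair ((hμ.comp (fst _ _)).pair ((hadv.comp (fst _ _)).snd'.fst'.pair (hadv.comp (fst _ _)).snd'.snd')) :)
  have hcoreIn : CodeFP (pairE AENR L) CORE (fun s =>
      ((qOf s.1.2.2.1 s.1.2.1, s.1.2.2.1),
        (IOf (ptsL (bOf s.1.2.2.1 s.1.2.1) s.1.2.1 (qOf s.1.2.2.1 s.1.2.1) s.1.2.2.2).length (JOf s.1.2.1), JOf s.1.2.1),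
        s.2, min (advFields s.1.1).1 (capOf s.1.2.2.1 s.1.2.1), (advFields s.1.1).2.1, (advFields s.1.1).2.2)) :=
    (hqn.pair (hIJp.pair hrest) :)
  have hsome := decodeCoreLC.comp hcoreIn
  have hcases := optCases (σ := List Bool × ℕ × ℕ × List Bool) (α := List ℤ) (δ := List Bool) (eσ := AENR) (eα := L) (eδ := strE)
    (k := fun s o => match o with
      | none => []
      | some w => decodeCoreL (max (qOf s.2.2.1 s.2.1) 2) s.2.2.1
          (IOf (ptsL (bOf s.2.2.1 s.2.1) s.2.1 (qOf s.2.2.1 s.2.1) s.2.2.2).length (JOf s.2.1)) (JOf s.2.1) w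
          (min (advFields s.1).1 (capOf s.2.2.1 s.2.1)) (advFields s.1).2.1 (advFields s.1).2.2)
    (const _ ([] : List Bool)) hsome (fun _ => rfl) (fun _ _ => rfl)
  refine (hcases.comp ((CodeFP.id _).pair (kerVecC.comp henr))).congr fun t => ?_
  obtain ⟨adv, e, n, r⟩ := t
  simp only [id]
  rw [max_eq_left (qOf_prime n e).two_le, decodeL, decodeWithL]
  all_goals (cases kerVecMod (qOf n e) (IOf (ptsL (bOf n e) e (qOf n e) r).length (JOf e) * JOf e) (rowsL (bOf n e) e (qOf n e) r) <;> rfl)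


/-! ### The encoder on codes -/

/-- **The Reed–Solomon symbol is a Horner value**: `symb q x β = hornerZ q (msgCoeffs x) β` (as integers). [folklore] -/
theorem symb_eq_hornerZ (q : ℕ) (β : ℕ) : ∀ x : List Bool, ((symb q x β : ℕ) : ℤ) = hornerZ q (msgCoeffs x) (β : ℤ)
  | [] => by simp [symb, hornerZ, msgCoeffs]
  | b :: x => by
    rw [symb, List.foldr_cons, ← symb, msgCoeffs, List.map_cons, ← msgCoeffs, hornerZ_cons, ← symb_eq_hornerZ q β x]
    push_cast
    cases b <;> simp

/-- The message coefficients on codes. [folklore] -/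
theorem msgCoeffsC : CodeFP strE L msgCoeffs := by
  have hb : CodeFP bitE intE (fun b => if b then (1 : ℤ) else 0) := (ite (CodeFP.id bitE) (const _ (1 : ℤ)) (const _ (0 : ℤ)) :)
  exact ((map₀ hb).comp strToRaw).congr fun _ => rfl

/-- **The symbol on codes**: `((q, x), β) ↦ symb q⁺ x β` (`q` unary). [cite: AroraBarakCC2009, §1.3, §19.3] -/
theorem symbC : CodeFP (pairE (pairE unE strE) natE) natE (fun t => symb (max t.1.1 2) t.1.2 t.2) := by
  have h : CodeFP (pairE (pairE unE strE) natE) intE (fun t => hornerZ (max t.1.1 2) (msgCoeffs t.1.2) (t.2 : ℤ)) :=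
    (hornerZC.comp ((fst _ _).fst'.pair ((msgCoeffsC.comp (fst _ _).snd').pair (intOfNat.comp (snd _ _)))) :)
  exact (intToNat.comp h).congr fun t => by simp only [← symb_eq_hornerZ, Int.toNat_natCast]

/-- The code of the encoder's input `(e, x)`. [folklore] -/
local notation "EX" => pairE unE strE

/-- `(e, n)` of `(e, x)`. [folklore] -/
theorem enOfEX : CodeFP EX EN (fun s => (s.1, s.2.length)) := ((fst _ _).pair (strLength.comp (snd _ _)) :)

/-- **The encoder on codes**: `(e, x) ↦ Enc_{n,1/e}(x)` (positions `p < 2^{2b}`: block `p / 2^b`,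
Reed–Solomon point `(p / 2^b) mod q`, Hadamard position `p mod 2^b`). [cite: Hirahara2018, Thm. 4.7] [cite: AroraBarakCC2009, §1.3, §19.3] -/
theorem encC : CodeFP EX strE (fun s => enc s.1 s.2) := by
  -- context `(e, x)`, item `p`
  have hb : CodeFP (pairE EX natE) unE (fun t => bOf t.1.2.length t.1.1) := (bOfUC.comp (enOfEX.comp (fst _ _)) :)
  have hB : CodeFP (pairE EX natE) natE (fun t => 2 ^ bOf t.1.2.length t.1.1) := (twoPowBC.comp (enOfEX.comp (fst _ _)) :)
  have hq : CodeFP (pairE EX natE) natE (fun t => qOf t.1.2.length t.1.1) := (qOfC.comp (enOfEX.comp (fst _ _)) :)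
  have hqU : CodeFP (pairE EX natE) unE (fun t => qOf t.1.2.length t.1.1) := (qOfUC.comp (enOfEX.comp (fst _ _)) :)
  have hβ : CodeFP (pairE EX natE) natE (fun t => t.2 / 2 ^ bOf t.1.2.length t.1.1 % qOf t.1.2.length t.1.1) :=
    (natMod.comp ((natDiv.comp ((snd _ _).pair hB)).pair hq) :)
  have hv : CodeFP (pairE EX natE) natE (fun t => symb (max (qOf t.1.2.length t.1.1) 2) t.1.2 (t.2 / 2 ^ bOf t.1.2.length t.1.1 % qOf t.1.2.length t.1.1)) :=
    (symbC.comp ((hqU.pair (fst _ _).snd').pair hβ) :)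
  have hbit : CodeFP (pairE EX natE) bitE (fun t => encBit (bOf t.1.2.length t.1.1) (qOf t.1.2.length t.1.1) t.1.2 t.2) :=
    (natEq.comp ((hadLC.comp (hb.pair (hv.pair (natMod.comp ((snd _ _).pair hB))))).pair (const _ 1))).congr fun t => by
      rw [encBit, hadN_eq_decide, max_eq_left (qOf_prime _ _).two_le]
  have hlen : CodeFP EX unE (fun s => 2 ^ bOf s.2.length s.1 * 2 ^ bOf s.2.length s.1) :=
    (unOfNat_of_le (natMul.comp ((twoPowBC.comp enOfEX).pair (twoPowBC.comp enOfEX))) (capUC.comp enOfEX) fun s =>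
      two_pow_bOf_sq_le_capOf _ _ :)
  refine (rawToStr.comp ((map hbit).comp ((CodeFP.id _).pair (urange.comp hlen)))).congr fun s => ?_
  obtain ⟨e, x⟩ := s
  simp only [id, enc, encWith]
  refine List.ext_getElem (by simp) fun i h1 h2 => ?_
  simp

/-! ### The string functions -/

/-- **`Enc` is polynomial time**: an `FP` string function mapping `⟨1ᵉ, x⟩` to `LDC.enc e x`.
[cite: Hirahara2018, Thm. 4.7] -/
theorem exists_encFn : ∃ f ∈ FP, ∀ (e : ℕ) (x : List Bool), f (boolPair (ones e) x) = enc e x := by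
  obtain ⟨f, hf, h⟩ := encC
  exact ⟨f, hf, fun e x => by simpa [pairE_apply, unE_eq_ones, strE] using h (e, x)⟩

/-- **`Dec` is polynomial time**: an `FP` string function mapping `⟨adv, ⟨1ᵉ, ⟨1ⁿ, r⟩⟩⟩` to
`LDC.decodeL e n r (min μ cap) β v`, `(μ, β, v) = advFields adv`. [cite: Hirahara2018, Thm. 4.7] -/
theorem exists_decFn : ∃ f ∈ FP, ∀ (adv : List Bool) (e n : ℕ) (r : List Bool),
    f (boolPair adv (boolPair (ones e) (boolPair (ones n) r))) =
      decodeL e n r (min (advFields adv).1 (capOf n e)) (advFields adv).2.1 (advFields adv).2.2 := by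
  obtain ⟨f, hf, h⟩ := decodeLC
  exact ⟨f, hf, fun adv e n r => by simpa [pairE_apply, unE_eq_ones, strE] using h (adv, e, n, r)⟩

end LDC

end Literature.Computability.MetaComplexity

end
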